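import Summits.QuantumFields.YangMills.Theorems.FluctuationComparisonRegPrIntLOrganTangentWeightLipOfChartLettersSeg
import HarnessLib

/-!
# Crux `FluctuationComparisonRegPrIntL` (stmt-QuantumFields-20520, rung R3), PATH-B organ, H-currency cone — (L44a) «SUPPORT EDITION, TOOLS»: Lipschitz from CONTINUITY + Lipschitz
# across ZERO-FREE OPEN SEGMENTS; and the CONTINUITY of the interpolated weight along near coarse paths FROM THE FRAME — so the chart letters of the (I-law) REG′ reduction are
# needed only INSIDE THE MULTI-WINDOW GOOD SET

Cell `ym3-torus` (YM ladder rung R3 = continuum `SU(2)` Yang–Mills on the three-torus — a RUNG: NOT d = 4, NOT infinite volume, NOT a mass gap, NOT Clay).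
Width seat `ym-ust-20520-w5` (gen 25), `--kind proof --supports stmt-QuantumFields-20520 --as helper`, count-neutral, DEFINITION-FREE, default heartbeats,
no registry ∕ binder ∕ `Lines/` edit.  Over ✓p823227 `…WeightLipOfChartLettersSeg` (import hub), ✓`…SigmaVersionChartMean.continuous_mul_of_support`,
✓`…N09DomAltThresholdNull.isOpen_setOf_plaqSmall_SU`, lit `B12ContinuousTransportInvarianceOn.continuous_dist1_SU ∕ continuous_plaqHol_SU`, ✓`…SeedHClause.eq_update_of_rel`,
`T4CubeChartExp.continuous_expPt`.

WHY.  ✓(L38)–(L42) ask the chart letters ((Φ-disp-Lip), (Φ-bond-incr-loc), (J-Lip)) on the whole parameter interval `Ioo (-1) 2` of a near coarse path — also where the cut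
vanishes, i.e. OUTSIDE the multi-window good set, where Bałaban's minimiser chart has no reason to be regular (TN-HDISP-FRAME (iii) needs an off-domain convention there).  But
`s ↦ wNum_t (X s) z` is CONTINUOUS on `Ioo (-1) 2` by the FRAME alone (window continuity [7] of the chart block + continuity of the cut and of the densities on the window), and a
continuous real function that is `K`-Lipschitz across every OPEN SEGMENT FREE OF ITS ZEROS is `K`-Lipschitz (nearest-zero splitting: between `x` and the first zero `r₁` the open
segment is zero-free, so `|P x| = |P x − P r₁| ≤ K·|x − r₁|`).  Hence the letters are needed only on closed parameter segments whose INTERIOR maps into the good set — ✓(L44b).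

WHAT.  §0 [folklore] `abs_sub_le_of_openSeg_aux`, ★★`lipschitzOnWith_of_continuousOn_of_openSeg` (convex `I ⊆ ℝ`, `ContinuousOn P I`, `∀ a b ∈ I, (∀ r ∈ uIoo a b, P r ≠ 0) →
|P a − P b| ≤ K·|a − b|` ⟹ `LipschitzOnWith K P I`; `IsClosed.csInf_mem ∕ csSup_mem` on the zero set of a segment).  §1 ★★`continuousOn_wNum_relPath` ∕ ★★`continuousOn_wNum_relSquare`:
FROM THE FRAME (`hχc`, `hχsupp`, `hρc hρ'c hρpos hθ`, the chart block's window-continuity clause [7] VERBATIM) the interpolated weight is continuous in the path parameter on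
`Ioo (-1) 2` along every near relational path (base in the `θ_j∕4`-window, guard `(1 + 16·√3·rc)·(θ_j∕4) ≤ θ_j`) and along every `s`-edge of a near relational square (`s′ ∈ Icc 0 1`).

HONEST FRAMING: [folklore] real analysis + window bookkeeping over the frame's HYPOTHESIS clauses; nothing of Bałaban's analysis is asserted or proved; the chart letters, KER′,
(I-curv), (I-cov), `hdisp`, `hdisp_n` untouched and OPEN; `OrganDischargeInputsHJ(sq)` ∕ `SpreadFibreLawH(J)(sq)` UNDISCHARGED; the five registered stubs of
`Lines/semiclassical_s2beta.lean`, crux 20520 and `YM3TorusSU2` are NOT proved; registry untouched; rung R3 = SU(2) YM₃ on T³ — NOT d = 4, NOT infinite volume, NOT a mass gap, NOT Clay;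
the Yang–Mills mass gap is NOT proved.  [folklore]
-/

set_option autoImplicit false

noncomputable section

namespace Summit.QuantumFields.YangMills.Theorems.OrganTangentSupportSegmentLipschitz

open MeasureTheory Filter Topology Set Function
open scoped ENNReal NNReal
open Literature.MathematicalPhysics.QuantumFieldTheory.Balaban1983to89 T3ContinuumYM3Torus T3NestedUnitLaws T3UnitLawDensityEML T4Continuum BalabanUVClass
  T3UnitScaleTilt T3LevelShift T3TiltDescent
open T4CubeChartExp (expPt continuous_expPt)
open Literature.MathematicalPhysics.QuantumFieldTheory.Balaban1983to89.B12ContinuousTransportInvarianceOn (continuous_dist1_SU continuous_plaqHol_SU)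
open Summit.QuantumFields.YangMills.BalabanUVNodes.N09DomAltThresholdNull (isOpen_setOf_plaqSmall_SU)
open Summit.QuantumFields.YangMills.Theorems.OrganTangentSigmaVersionChartMean (continuous_mul_of_support)
open Summit.QuantumFields.YangMills.Theorems.FluctuationComparisonRegPrIntLRunpairOrganFibreLaw (mwCut wNum)
open Summit.QuantumFields.YangMills.Theorems.OrganTangentILawKnitFacts (plaqSmall_mono abs_le_two_of_mem_Icc)
open Summit.QuantumFields.YangMills.Theorems.OrganTangentRelPathWindow (plaqSmall_relPath_of_le plaqSmall_relSquare_of_le)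
open Summit.QuantumFields.YangMills.Theorems.OrganTangentNearStability (guard8_of_guard16)
open Summit.QuantumFields.YangMills.Theorems.OrganTangentSeedHClause (eq_update_of_rel)
open Summit.QuantumFields.YangMills.Theorems.OrganTangentILawRegOfWeightLip (abs_le_two_of_mem_Ioo)

/-! ## §0 Folklore: Lipschitz from continuity + Lipschitz across zero-free open segments -/

section Folklore

/-- One ordered segment: `P` continuous on `[x, y]` and `K`-Lipschitz across every sub-segment with zero-free INTERIOR ⟹ `|P x − P y| ≤ K·(y − x)` (split at the smallest and the
largest zero). [folklore] -/
theorem abs_sub_le_of_openSeg_aux {P : ℝ → ℝ} {K : ℝ} (hK : 0 ≤ K) {x y : ℝ} (hxy : x ≤ y)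
    (hP : ContinuousOn P (Icc x y))
    (hseg : ∀ a ∈ Icc x y, ∀ b ∈ Icc x y, a ≤ b → (∀ r ∈ Ioo a b, P r ≠ 0) → |P a - P b| ≤ K * (b - a)) :
    |P x - P y| ≤ K * (y - x) := by
  by_cases hT : ∃ r ∈ Icc x y, P r = 0
  · set T : Set ℝ := Icc x y ∩ P ⁻¹' {0} with hTdef
    have hTc : IsClosed T := hP.preimage_isClosed_of_isClosed isClosed_Icc isClosed_singleton
    have hTne : T.Nonempty := by obtain ⟨r, hr, hPr⟩ := hT; exact ⟨r, hr, hPr⟩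
    have hTbdd : BddBelow T := ⟨x, fun r hr => hr.1.1⟩
    have hTbdd' : BddAbove T := ⟨y, fun r hr => hr.1.2⟩
    set r₁ := sInf T with hr₁
    set r₂ := sSup T with hr₂
    have hr₁T : r₁ ∈ T := hTc.csInf_mem hTne hTbdd
    have hr₂T : r₂ ∈ T := hTc.csSup_mem hTne hTbdd'
    have hP₁ : P r₁ = 0 := hr₁T.2
    have hP₂ : P r₂ = 0 := hr₂T.2
    have h12 : r₁ ≤ r₂ := csInf_le_csSup hTne hTbdd hTbdd'
    have hleft : ∀ r ∈ Ioo x r₁, P r ≠ 0 := by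
      intro r hr hPr
      have hrT : r ∈ T := ⟨⟨hr.1.le, hr.2.le.trans hr₁T.1.2⟩, hPr⟩
      exact (not_le.2 hr.2) (csInf_le hTbdd hrT)
    have hright : ∀ r ∈ Ioo r₂ y, P r ≠ 0 := by
      intro r hr hPr
      have hrT : r ∈ T := ⟨⟨hr₂T.1.1.trans hr.1.le, hr.2.le⟩, hPr⟩
      exact (not_le.2 hr.1) (le_csSup hTbdd' hrT)
    have hx1 := hseg x ⟨le_rfl, hxy⟩ r₁ hr₁T.1 hr₁T.1.1 hleft
    have hy2 := hseg r₂ hr₂T.1 y ⟨hxy, le_rfl⟩ hr₂T.1.2 hright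
    rw [hP₁, sub_zero] at hx1
    rw [hP₂, zero_sub, abs_neg] at hy2
    calc |P x - P y| ≤ |P x| + |P y| := abs_sub _ _
      _ ≤ K * (r₁ - x) + K * (y - r₂) := add_le_add hx1 hy2
      _ ≤ K * (y - x) := by nlinarith
  · push Not at hT
    exact hseg x ⟨le_rfl, hxy⟩ y ⟨hxy, le_rfl⟩ hxy fun r hr => hT r ⟨hr.1.le, hr.2.le⟩

/-- ★★ **LIPSCHITZ FROM CONTINUITY + LIPSCHITZ ACROSS ZERO-FREE OPEN SEGMENTS** on a convex real set. [folklore] -/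
theorem lipschitzOnWith_of_continuousOn_of_openSeg {P : ℝ → ℝ} {I : Set ℝ} (hI : Convex ℝ I) (hP : ContinuousOn P I) {K : ℝ≥0}
    (hseg : ∀ a ∈ I, ∀ b ∈ I, (∀ r ∈ Set.uIoo a b, P r ≠ 0) → |P a - P b| ≤ K * |a - b|) :
    LipschitzOnWith K P I := by
  refine LipschitzOnWith.of_dist_le_mul fun x hx y hy => ?_
  rw [Real.dist_eq, Real.dist_eq]
  have hOC : I.OrdConnected := hI.ordConnected
  rcases le_total x y with hxy | hyx
  · have hsub : Icc x y ⊆ I := hOC.out hx hy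
    have h := abs_sub_le_of_openSeg_aux (NNReal.coe_nonneg K) hxy (hP.mono hsub) fun a ha b hb hab hz => by
      have := hseg a (hsub ha) b (hsub hb) (by rwa [Set.uIoo_of_le hab])
      rwa [abs_of_nonpos (sub_nonpos.2 hab), neg_sub] at this
    rwa [abs_of_nonpos (sub_nonpos.2 hxy), neg_sub]
  · have hsub : Icc y x ⊆ I := hOC.out hy hx
    have h := abs_sub_le_of_openSeg_aux (NNReal.coe_nonneg K) hyx (hP.mono hsub) fun a ha b hb hab hz => by
      have := hseg a (hsub ha) b (hsub hb) (by rwa [Set.uIoo_of_le hab])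
      rwa [abs_of_nonpos (sub_nonpos.2 hab), neg_sub] at this
    rw [abs_sub_comm] at h
    rwa [abs_of_nonneg (sub_nonneg.2 hyx)]

end Folklore

/-! ## §1 The interpolated weight is continuous along near coarse paths — from the frame -/

section Continuity

variable (F : T3Family) (γ b₀ p₀ : ℝ) (j Ts : ℕ)

/-- The fine-field factor `U ↦ χ(U)·ρ_Ts(U)^t·ρ′_Ts(U)^{1−t}` is continuous on the whole fine-field space (cut continuous and supported in the closed `24∕25·θ_Ts`-window, densities
continuous and positive on the open `θ_Ts`-window; ✓`continuous_mul_of_support`). [folklore] -/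
theorem continuous_cutDensityFactor (hjTs : j + 1 ≤ Ts)
    (ρ ρ' : (i : ℕ) → GaugeField (F.P i) 0 ↥(Matrix.specialUnitaryGroup (Fin 2) ℂ) → ℝ)
    (hρc : ContinuousOn (ρ Ts) {U | PlaqSmall (θBal F.L γ b₀ p₀ Ts) U}) (hρ'c : ContinuousOn (ρ' Ts) {U | PlaqSmall (θBal F.L γ b₀ p₀ Ts) U})
    (hρpos : ∀ U, PlaqSmall (θBal F.L γ b₀ p₀ Ts) U → 0 < ρ Ts U ∧ 0 < ρ' Ts U) (hθ : 0 < θBal F.L γ b₀ p₀ Ts)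
    (hχc : Continuous (mwCut F γ b₀ p₀ j Ts))
    (hχsupp : ∀ U, mwCut F γ b₀ p₀ j Ts U ≠ 0 → ∀ (n : ℕ) (hjn : j + 1 ≤ n) (hnK : n ≤ Ts), PlaqSmall (24 / 25 * θBal F.L γ b₀ p₀ n) (descendTo F ℰp n Ts hnK U))
    (t : ℝ) :
    Continuous (fun U : GaugeField (F.P Ts) 0 ↥(Matrix.specialUnitaryGroup (Fin 2) ℂ) =>
      mwCut F γ b₀ p₀ j Ts U * (Real.rpow (ρ Ts U) t * Real.rpow (ρ' Ts U) (1 - t))) := by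
  set C : Set (GaugeField (F.P Ts) 0 ↥(Matrix.specialUnitaryGroup (Fin 2) ℂ)) :=
    {U | ∀ p, dist1 (GaugeField.plaqHol U p) ≤ 24 / 25 * θBal F.L γ b₀ p₀ Ts} with hC
  have hCclosed : IsClosed C := by
    have : C = ⋂ p, {U | dist1 (GaugeField.plaqHol U p) ≤ 24 / 25 * θBal F.L γ b₀ p₀ Ts} := by
      ext U; simp only [hC, Set.mem_setOf_eq, Set.mem_iInter]
    rw [this]
    exact isClosed_iInter fun p => isClosed_le ((continuous_dist1_SU (N := 2)).comp (continuous_plaqHol_SU (N := 2) p)) continuous_const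
  have hO : IsOpen {U : GaugeField (F.P Ts) 0 ↥(Matrix.specialUnitaryGroup (Fin 2) ℂ) | PlaqSmall (θBal F.L γ b₀ p₀ Ts) U} :=
    isOpen_setOf_plaqSmall_SU 2 _ _ _
  have hCO : C ⊆ {U | PlaqSmall (θBal F.L γ b₀ p₀ Ts) U} := fun U hU p => lt_of_le_of_lt (hU p) (by linarith)
  have hχC : ∀ U, mwCut F γ b₀ p₀ j Ts U ≠ 0 → U ∈ C := by
    intro U hU p
    have h := hχsupp U hU Ts hjTs le_rfl p
    rw [T3DescentFibreTower.descendTo_self] at h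
    exact h.le
  have hgc : ContinuousOn (fun U => Real.rpow (ρ Ts U) t * Real.rpow (ρ' Ts U) (1 - t)) {U | PlaqSmall (θBal F.L γ b₀ p₀ Ts) U} := by
    simp only [Real.rpow_eq_pow]
    exact (hρc.rpow_const fun U hU => Or.inl (hρpos U hU).1.ne').mul (hρ'c.rpow_const fun U hU => Or.inl (hρpos U hU).2.ne')
  exact continuous_mul_of_support hO hCclosed hCO hχc hχC hgc

/-- ★★ **THE INTERPOLATED WEIGHT IS CONTINUOUS IN THE PATH PARAMETER ALONG A NEAR RELATIONAL PATH** (on `Set.Ioo (-1) 2`), from the frame: the chart block's window-continuity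
clause [7] (binder VERBATIM), the cut's continuity and support, the densities' window continuity∕positivity, the guard. [folklore] -/
theorem continuousOn_wNum_relPath (hjTs : j + 1 ≤ Ts)
    (ρ ρ' : (i : ℕ) → GaugeField (F.P i) 0 ↥(Matrix.specialUnitaryGroup (Fin 2) ℂ) → ℝ)
    (hρc : ContinuousOn (ρ Ts) {U | PlaqSmall (θBal F.L γ b₀ p₀ Ts) U}) (hρ'c : ContinuousOn (ρ' Ts) {U | PlaqSmall (θBal F.L γ b₀ p₀ Ts) U})
    (hρpos : ∀ U, PlaqSmall (θBal F.L γ b₀ p₀ Ts) U → 0 < ρ Ts U ∧ 0 < ρ' Ts U) (hθ : 0 < θBal F.L γ b₀ p₀ Ts)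
    (hχc : Continuous (mwCut F γ b₀ p₀ j Ts))
    (hχsupp : ∀ U, mwCut F γ b₀ p₀ j Ts U ≠ 0 → ∀ (n : ℕ) (hjn : j + 1 ≤ n) (hnK : n ≤ Ts), PlaqSmall (24 / 25 * θBal F.L γ b₀ p₀ n) (descendTo F ℰp n Ts hnK U))
    {Z : Type} (Φ : GaugeField (F.P j) 0 ↥(Matrix.specialUnitaryGroup (Fin 2) ℂ) × Z → GaugeField (F.P Ts) 0 ↥(Matrix.specialUnitaryGroup (Fin 2) ℂ))
    (J : GaugeField (F.P j) 0 ↥(Matrix.specialUnitaryGroup (Fin 2) ℂ) × Z → ℝ≥0)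
    (hcont : ∀ f : GaugeField (F.P Ts) 0 ↥(Matrix.specialUnitaryGroup (Fin 2) ℂ) → ℝ, Continuous f →
      (∀ U, f U ≠ 0 → (∀ (n : ℕ) (hjn : j + 1 ≤ n) (hnK : n ≤ Ts), PlaqSmall (24 / 25 * θBal F.L γ b₀ p₀ n) (descendTo F ℰp n Ts hnK U))) →
      ∀ z, ContinuousOn (fun V => (J (V, z) : ℝ) * f (Φ (V, z))) {V | PlaqSmall (θBal F.L γ b₀ p₀ j) V})
    (hθj : 0 < θBal F.L γ b₀ p₀ j) (rc : ℝ) (hrc : 0 ≤ rc) (hguard : (1 + 16 * Real.sqrt 3 * rc) * (θBal F.L γ b₀ p₀ j / 4) ≤ θBal F.L γ b₀ p₀ j) (t : ℝ)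
    (B' : PBond (F.P j) 0) (m' : Fin 3 → ℝ) (U₂ : GaugeField (F.P j) 0 ↥(Matrix.specialUnitaryGroup (Fin 2) ℂ))
    (X : ℝ → GaugeField (F.P j) 0 ↥(Matrix.specialUnitaryGroup (Fin 2) ℂ)) (hm' : ‖m'‖ ≤ rc * (θBal F.L γ b₀ p₀ j / 4)) (hU₂ : PlaqSmall (θBal F.L γ b₀ p₀ j / 4) U₂)
    (hoff : ∀ s e, e ≠ B' → X s e = U₂ e) (hon : ∀ s, X s B' = U₂ B' * expPt (s • m')) (z : Z) :
    ContinuousOn (fun s => wNum F γ b₀ p₀ j Ts ρ ρ' Φ J t (X s) z) (Set.Ioo (-1) 2) := by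
  have hfc := continuous_cutDensityFactor F γ b₀ p₀ j Ts hjTs ρ ρ' hρc hρ'c hρpos hθ hχc hχsupp t
  have hV := hcont _ hfc (fun U hU => hχsupp U (left_ne_zero_of_mul hU)) z
  -- the path is continuous and stays in the `θ_j`-window
  have hX : X = fun s => update U₂ B' (U₂ B' * expPt (s • m')) := funext fun s => eq_update_of_rel (hoff s) (hon s)
  have hXc : Continuous X := by
    rw [hX]
    exact continuous_const.update B' (continuous_const.mul (continuous_expPt.comp (continuous_id.smul continuous_const)))
  have hXw : Set.MapsTo X (Set.Ioo (-1) 2) {V | PlaqSmall (θBal F.L γ b₀ p₀ j) V} := fun s hs =>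
    plaqSmall_mono (guard8_of_guard16 hrc hθj.le hguard) (plaqSmall_relPath_of_le hU₂ hm' hoff hon (abs_le_two_of_mem_Ioo hs))
  have h := hV.comp hXc.continuousOn hXw
  refine h.congr fun s _ => ?_
  simp only [Function.comp, wNum]
  ring

/-- ★★ **THE SAME ALONG AN `s`-EDGE OF A NEAR RELATIONAL SQUARE** (`s′ ∈ Icc 0 1` fixed). [folklore] -/
theorem continuousOn_wNum_relSquare (hjTs : j + 1 ≤ Ts)
    (ρ ρ' : (i : ℕ) → GaugeField (F.P i) 0 ↥(Matrix.specialUnitaryGroup (Fin 2) ℂ) → ℝ)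
    (hρc : ContinuousOn (ρ Ts) {U | PlaqSmall (θBal F.L γ b₀ p₀ Ts) U}) (hρ'c : ContinuousOn (ρ' Ts) {U | PlaqSmall (θBal F.L γ b₀ p₀ Ts) U})
    (hρpos : ∀ U, PlaqSmall (θBal F.L γ b₀ p₀ Ts) U → 0 < ρ Ts U ∧ 0 < ρ' Ts U) (hθ : 0 < θBal F.L γ b₀ p₀ Ts)
    (hχc : Continuous (mwCut F γ b₀ p₀ j Ts))
    (hχsupp : ∀ U, mwCut F γ b₀ p₀ j Ts U ≠ 0 → ∀ (n : ℕ) (hjn : j + 1 ≤ n) (hnK : n ≤ Ts), PlaqSmall (24 / 25 * θBal F.L γ b₀ p₀ n) (descendTo F ℰp n Ts hnK U))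
    {Z : Type} (Φ : GaugeField (F.P j) 0 ↥(Matrix.specialUnitaryGroup (Fin 2) ℂ) × Z → GaugeField (F.P Ts) 0 ↥(Matrix.specialUnitaryGroup (Fin 2) ℂ))
    (J : GaugeField (F.P j) 0 ↥(Matrix.specialUnitaryGroup (Fin 2) ℂ) × Z → ℝ≥0)
    (hcont : ∀ f : GaugeField (F.P Ts) 0 ↥(Matrix.specialUnitaryGroup (Fin 2) ℂ) → ℝ, Continuous f →
      (∀ U, f U ≠ 0 → (∀ (n : ℕ) (hjn : j + 1 ≤ n) (hnK : n ≤ Ts), PlaqSmall (24 / 25 * θBal F.L γ b₀ p₀ n) (descendTo F ℰp n Ts hnK U))) →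
      ∀ z, ContinuousOn (fun V => (J (V, z) : ℝ) * f (Φ (V, z))) {V | PlaqSmall (θBal F.L γ b₀ p₀ j) V})
    (rc : ℝ) (hguard : (1 + 16 * Real.sqrt 3 * rc) * (θBal F.L γ b₀ p₀ j / 4) ≤ θBal F.L γ b₀ p₀ j) (t : ℝ)
    (B B' : PBond (F.P j) 0) (m m' : Fin 3 → ℝ) (V00 : GaugeField (F.P j) 0 ↥(Matrix.specialUnitaryGroup (Fin 2) ℂ))
    (Y : ℝ → GaugeField (F.P j) 0 ↥(Matrix.specialUnitaryGroup (Fin 2) ℂ)) (X : ℝ → ℝ → GaugeField (F.P j) 0 ↥(Matrix.specialUnitaryGroup (Fin 2) ℂ))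
    (hm : ‖m‖ ≤ rc * (θBal F.L γ b₀ p₀ j / 4)) (hm' : ‖m'‖ ≤ rc * (θBal F.L γ b₀ p₀ j / 4)) (hV : PlaqSmall (θBal F.L γ b₀ p₀ j / 4) V00)
    (hYoff : ∀ s e, e ≠ B → Y s e = V00 e) (hYon : ∀ s, Y s B = V00 B * expPt (s • m))
    (hXoff : ∀ s s' e, e ≠ B' → X s s' e = Y s e) (hXon : ∀ s s', X s s' B' = Y s B' * expPt (s' • m'))
    {s' : ℝ} (hs' : s' ∈ Set.Icc (0 : ℝ) 1) (z : Z) :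
    ContinuousOn (fun s => wNum F γ b₀ p₀ j Ts ρ ρ' Φ J t (X s s') z) (Set.Ioo (-1) 2) := by
  have hfc := continuous_cutDensityFactor F γ b₀ p₀ j Ts hjTs ρ ρ' hρc hρ'c hρpos hθ hχc hχsupp t
  have hVc := hcont _ hfc (fun U hU => hχsupp U (left_ne_zero_of_mul hU)) z
  have hY : Y = fun s => update V00 B (V00 B * expPt (s • m)) := funext fun s => eq_update_of_rel (hYoff s) (hYon s)
  have hYc : Continuous Y := by
    rw [hY]
    exact continuous_const.update B (continuous_const.mul (continuous_expPt.comp (continuous_id.smul continuous_const)))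
  have hXe : (fun s => X s s') = fun s => update (Y s) B' (Y s B' * expPt (s' • m')) := funext fun s => eq_update_of_rel (hXoff s s') (hXon s s')
  have hXc : Continuous (fun s => X s s') := by
    rw [hXe]
    exact hYc.update B' (((continuous_apply B').comp hYc).mul continuous_const)
  have hXw : Set.MapsTo (fun s => X s s') (Set.Ioo (-1) 2) {V | PlaqSmall (θBal F.L γ b₀ p₀ j) V} := fun s hs =>
    plaqSmall_mono hguard (plaqSmall_relSquare_of_le hV hm hm' hYoff hYon hXoff hXon (abs_le_two_of_mem_Ioo hs) (abs_le_two_of_mem_Icc hs'))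
  have h := hVc.comp hXc.continuousOn hXw
  refine h.congr fun s _ => ?_
  simp only [Function.comp, wNum]
  ring

end Continuity

end Summit.QuantumFields.YangMills.Theorems.OrganTangentSupportSegmentLipschitz

end
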